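import Literature.IUT.HodgeArakelov.KummerPrimeStripCategories
import Literature.IUT.HodgeArakelov.LocalTriMuDataSplitIso

/-!
# [IUTchII] Def 4.9 (vii): the groupoid of `F^{⊢▶×μ}`-prime-strips with PRINT-LEVEL (split) morphisms, and the
# FULL functor "passing to `F^{⊢×μ}`"

Owner file (abc-iut cell, layer L6; abc-iut-L6-t2; nothing landed is re-typed). S. Mochizuki, *Inter-universal
Teichmüller theory II*, kurims Dec-2020 manuscript, Def 4.9 (ii)–(iv) pp. 155–156 ("`O^{▶×μ}(‡A) := O^▶(‡A) ×
O^{×μ}(‡A)` … the direct product monoid"), (vii) p. 158 ("A morphism of `F^{⊢▶×μ}`-prime-strips is defined to be a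
collection of isomorphisms, indexed by `V`, between the various constituent objects of the prime-strips").
[claim: Mochizuki2012, status: disputed]; nothing here takes a side on [IUTchIII] Cor 3.12.

`KummerPrimeStripCategories.lean` (p411787) made `FTriMuPrimeStrip P G X` a groupoid with the `O^▷`-LEVEL local
isomorphisms `LocalTriMuDatum.Iso` as morphisms (the morphisms of the underlying `F^⊢`-prime-strips), and
`FTimesMuPrimeStrip` (morphisms `LocalTriMuDatum.MuIso`) with `FTriMuPrimeStrip.toTimesMuFunctor` — which is NOT
full (abc-iut-w4-d028's witness p411899). `LocalTriMuDataSplitIso.lean` typed the print-level local morphisms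
`LocalTriMuDatum.SplitIso = (O^▶-isomorphism, ×μ-isomorphism)` of the direct-product data. Here:
* `FSplitTriMuPrimeStrip P G X` — the same objects (a one-field wrapper, so that the type carries its own category
  instance) with morphisms the `V`-indexed collections of SPLIT isomorphisms: the print-level groupoid of
  `F^{⊢▶×μ}`-prime-strips; kit-rule connectedness `iso_nonempty_of_model`;
* `FSplitTriMuPrimeStrip.toTimesMuFunctor : FSplitTriMuPrimeStrip ⥤ FTimesMuPrimeStrip` ("passing to `F^{⊢×μ}`")
  and **`toTimesMuFunctor_full_of_model`**: it is FULL as soon as every strip is isomorphic to a model strip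
  (PROVED) — the formal content behind "(full poly-isomorphism of `F^{⊩▶×μ}`-strips) ↦ full poly-isomorphism of
  `F^{⊢×μ}`-prime-strips" in [IUTchII] Cor 4.10 (iv);
* `FTriMuPrimeStrip.toSplitFunctor : FTriMuPrimeStrip ⥤ FSplitTriMuPrimeStrip` (an `O^▷`-level isomorphism IS a
  split one) with `toSplitFunctor ⋙ toTimesMuFunctor = FTriMuPrimeStrip.toTimesMuFunctor`.
Consumers: abc-iut-L6-t3 `StripFrame.ofKits` (`Fvtxm := FSplitTriMuPrimeStrip`, `FvtxmToFxm := toTimesMuFunctor`),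
the `UnitMuCoric` residual (GAP-LEDGER G-w4d028-1).
-/

namespace Literature.IUT.HodgeArakelov

open CategoryTheory

universe u v w

variable {V : Type u} {P : PlaceData V} {G : V → Type u} [∀ v, Group (G v)]
  {X : ∀ v, GroupTheoreticUnits.{u, w} (G v)}

/-- **An `F^{⊢▶×μ}`-prime-strip, print-level presentation** ([IUTchII] Def 4.9 (vi)–(vii)): the collection of
local data of Def 4.9 (vi) (an `FTriMuPrimeStrip`), wrapped so that its morphisms are the SPLIT isomorphisms of the
direct-product data `O^{▶×μ} = O^▶ × O^{×μ}`. [cite: Mochizuki2012, Def 4.9 (vii) p.158] -/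
structure FSplitTriMuPrimeStrip (P : PlaceData V) (G : V → Type u) [∀ v, Group (G v)]
    (X : ∀ v, GroupTheoreticUnits.{u, w} (G v)) : Type (max u (v + 1) w) where
  /-- the underlying collection of local data -/
  data : FTriMuPrimeStrip.{u, v, w} P G X

namespace FSplitTriMuPrimeStrip

/-- **IUTchII Def 4.9 (vii) p. 158, print level**: the groupoid of `F^{⊢▶×μ}`-prime-strips — a morphism is a
`V`-indexed collection of split isomorphisms `(O^▶ ⥲ O^▶, ×μ-isomorphism)` of the local data; composition,
identities and inverses componentwise. [cite: Mochizuki2012, Def 4.9 (vii) p.158] -/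
instance instGroupoid : Groupoid (FSplitTriMuPrimeStrip.{u, v, w} P G X) where
  Hom S T := ∀ v : V, LocalTriMuDatum.SplitIso (S.data.localDatum v) (T.data.localDatum v)
  id S := fun v => LocalTriMuDatum.SplitIso.refl (S.data.localDatum v)
  comp f g := fun v => (f v).trans (g v)
  id_comp f := funext fun v => LocalTriMuDatum.SplitIso.refl_trans (f v)
  comp_id f := funext fun v => LocalTriMuDatum.SplitIso.trans_refl (f v)
  assoc f g h := funext fun v => LocalTriMuDatum.SplitIso.trans_assoc (f v) (g v) (h v)
  inv f := fun v => (f v).symm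
  inv_comp f := funext fun v => LocalTriMuDatum.SplitIso.symm_trans (f v)
  comp_inv f := funext fun v => LocalTriMuDatum.SplitIso.trans_symm (f v)

/-- Morphisms are `V`-indexed collections of split isomorphisms (definitional unfolding).
[cite: Mochizuki2012, Def 4.9 (vii) p.158] -/
theorem hom_eq (S T : FSplitTriMuPrimeStrip.{u, v, w} P G X) :
    (S ⟶ T) = ∀ v : V, LocalTriMuDatum.SplitIso (S.data.localDatum v) (T.data.localDatum v) := rfl

/-- Composition is componentwise `trans`. (bookkeeping). [cite: Mochizuki2012, Def 4.9 (vii) p.158] -/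
@[simp] theorem comp_apply {S T U : FSplitTriMuPrimeStrip.{u, v, w} P G X} (f : S ⟶ T) (g : T ⟶ U) (v : V) :
    (f ≫ g) v = (f v).trans (g v) := rfl

/-- Identities are componentwise `refl`. (bookkeeping). [cite: Mochizuki2012, Def 4.9 (vii) p.158] -/
@[simp] theorem id_apply (S : FSplitTriMuPrimeStrip.{u, v, w} P G X) (v : V) :
    (𝟙 S : S ⟶ S) v = LocalTriMuDatum.SplitIso.refl (S.data.localDatum v) := rfl

/-- A collection of local split isomorphisms IS an isomorphism in the groupoid. [cite: Mochizuki2012, Def 4.9 (vii) p.158] -/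
def isoOfLocal {S T : FSplitTriMuPrimeStrip.{u, v, w} P G X}
    (f : ∀ v : V, LocalTriMuDatum.SplitIso (S.data.localDatum v) (T.data.localDatum v)) : S ≅ T :=
  Groupoid.isoEquivHom S T |>.symm f

/-- KIT-RULE connectedness (Def 4.9 (vii): every strip is "isomorphic to `‡F^{⊢▶×μ}`", the model): if every strip
is isomorphic to a fixed model strip then any two are isomorphic. [cite: Mochizuki2012, Def 4.9 (vii) p.158] -/
theorem iso_nonempty_of_model (M : FSplitTriMuPrimeStrip.{u, v, w} P G X)
    (h : ∀ S : FSplitTriMuPrimeStrip.{u, v, w} P G X, Nonempty (S ≅ M)) (S T : FSplitTriMuPrimeStrip.{u, v, w} P G X) :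
    Nonempty (S ≅ T) := by
  obtain ⟨e⟩ := h S
  obtain ⟨e'⟩ := h T
  exact ⟨e ≪≫ e'.symm⟩

/-- **"Passing to `F^{⊢×μ}`" as a functor on the print-level groupoid** (Def 4.9 (vi)–(vii); the
`StripFrame.FvtxmToFxm` shape): keep the data, take the `×μ`-component of each local split isomorphism.
[cite: Mochizuki2012, Def 4.9 (vii) p.158] -/
def toTimesMuFunctor : FSplitTriMuPrimeStrip.{u, v, w} P G X ⥤ FTimesMuPrimeStrip.{u, v, w} P G X where
  obj S := ⟨S.data⟩
  map f := fun v => (f v).toMuIso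
  map_id S := funext fun v => LocalTriMuDatum.SplitIso.toMuIso_refl (S.data.localDatum v)
  map_comp f g := funext fun v => LocalTriMuDatum.SplitIso.toMuIso_trans (f v) (g v)

/-- On objects the functor keeps the underlying data. [cite: Mochizuki2012, Def 4.9 (vii) p.158] -/
@[simp] theorem toTimesMuFunctor_obj (S : FSplitTriMuPrimeStrip.{u, v, w} P G X) :
    (toTimesMuFunctor.obj S).data = S.data := rfl

/-- On morphisms it is componentwise `toMuIso`. [cite: Mochizuki2012, Def 4.9 (vii) p.158] -/
@[simp] theorem toTimesMuFunctor_map {S T : FSplitTriMuPrimeStrip.{u, v, w} P G X} (f : S ⟶ T) (v : V) :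
    (toTimesMuFunctor.map f) v = (f v).toMuIso := rfl

/-- **Fullness of "passing to `F^{⊢×μ}`", local-nonemptiness form**: if between any two strips a split
isomorphism exists at every place, every collection of `×μ`-isomorphisms lifts to a morphism of
`F^{⊢▶×μ}`-prime-strips. PROVED (componentwise `SplitIso.toMuIso_surjective_of_nonempty`).
[cite: Mochizuki2012, Def 4.9 (vii) p.158] -/
theorem toTimesMuFunctor_full_of_nonempty
    (h : ∀ (S T : FSplitTriMuPrimeStrip.{u, v, w} P G X) (v : V),
      Nonempty (LocalTriMuDatum.SplitIso (S.data.localDatum v) (T.data.localDatum v))) :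
    (toTimesMuFunctor : FSplitTriMuPrimeStrip.{u, v, w} P G X ⥤ _).Full where
  map_surjective {S T} g :=
    ⟨fun v => (LocalTriMuDatum.SplitIso.toMuIso_surjective_of_nonempty (h S T v) (g v)).choose,
      funext fun v => (LocalTriMuDatum.SplitIso.toMuIso_surjective_of_nonempty (h S T v) (g v)).choose_spec⟩

/-- **Fullness of "passing to `F^{⊢×μ}`", kit-rule form** (the formal content behind [IUTchII] Cor 4.10 (iv)
"full poly-isomorphism of `F^{⊢×μ}`-prime-strips"): if every `F^{⊢▶×μ}`-prime-strip is isomorphic to a model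
strip (Def 4.9 (vii): "isomorphic to `‡F^{⊢▶×μ}`"), then `toTimesMuFunctor` is FULL. PROVED.
[cite: Mochizuki2012, Def 4.9 (vii) p.158] -/
theorem toTimesMuFunctor_full_of_model (M : FSplitTriMuPrimeStrip.{u, v, w} P G X)
    (hM : ∀ S : FSplitTriMuPrimeStrip.{u, v, w} P G X, Nonempty (S ≅ M)) :
    (toTimesMuFunctor : FSplitTriMuPrimeStrip.{u, v, w} P G X ⥤ _).Full :=
  toTimesMuFunctor_full_of_nonempty fun S T v => (iso_nonempty_of_model M hM S T).elim fun e => ⟨e.hom v⟩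

/-- Under fullness, every isomorphism of `F^{⊢×μ}`-prime-strips between images lifts to an isomorphism of
`F^{⊢▶×μ}`-prime-strips ("full poly-isomorphism ↦ full poly-isomorphism"). [cite: Mochizuki2012, Def 4.9 (vii) p.158] -/
theorem mapIso_surjective_of_model (M : FSplitTriMuPrimeStrip.{u, v, w} P G X)
    (hM : ∀ S : FSplitTriMuPrimeStrip.{u, v, w} P G X, Nonempty (S ≅ M)) (S T : FSplitTriMuPrimeStrip.{u, v, w} P G X) :
    Function.Surjective
      (fun e : S ≅ T => (toTimesMuFunctor : FSplitTriMuPrimeStrip.{u, v, w} P G X ⥤ _).mapIso e) := by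
  haveI := toTimesMuFunctor_full_of_model M hM
  intro g
  obtain ⟨f, hf⟩ := (toTimesMuFunctor : FSplitTriMuPrimeStrip.{u, v, w} P G X ⥤ _).map_surjective g.hom
  exact ⟨Groupoid.isoEquivHom S T |>.symm f, Iso.ext hf⟩

end FSplitTriMuPrimeStrip

namespace FTriMuPrimeStrip

/-- **An `O^▷`-level morphism IS a print-level one**: the functor from the groupoid with `O^▷`-level morphisms
(`LocalTriMuDatum.Iso`, the `F^⊢`-prime-strip morphisms of the same data) to the print-level groupoid,
componentwise `Iso.toSplitIso`. [cite: Mochizuki2012, Def 4.9 (vii) p.158] -/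
def toSplitFunctor : FTriMuPrimeStrip.{u, v, w} P G X ⥤ FSplitTriMuPrimeStrip.{u, v, w} P G X where
  obj S := ⟨S⟩
  map f := fun v => (f v).toSplitIso
  map_id S := funext fun v => LocalTriMuDatum.Iso.toSplitIso_refl (S.localDatum v)
  map_comp f g := funext fun v => LocalTriMuDatum.Iso.toSplitIso_trans (f v) (g v)

/-- On objects `toSplitFunctor` keeps the data. [cite: Mochizuki2012, Def 4.9 (vii) p.158] -/
@[simp] theorem toSplitFunctor_obj (S : FTriMuPrimeStrip.{u, v, w} P G X) : (toSplitFunctor.obj S).data = S := rfl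

/-- On morphisms it is componentwise `toSplitIso`. [cite: Mochizuki2012, Def 4.9 (vii) p.158] -/
@[simp] theorem toSplitFunctor_map {S T : FTriMuPrimeStrip.{u, v, w} P G X} (f : S ⟶ T) (v : V) :
    (toSplitFunctor.map f) v = (f v).toSplitIso := rfl

/-- The `O^▷`-level "passing to `F^{⊢×μ}`" factors through the print-level one, on morphisms:
`toMuIso ∘ toSplitIso = toMuIso` componentwise. [cite: Mochizuki2012, Def 4.9 (vii) p.158] -/
theorem toTimesMuFunctor_map_toSplitFunctor_map {S T : FTriMuPrimeStrip.{u, v, w} P G X} (f : S ⟶ T) :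
    FSplitTriMuPrimeStrip.toTimesMuFunctor.map (toSplitFunctor.map f) =
      (toTimesMuFunctor : FTriMuPrimeStrip.{u, v, w} P G X ⥤ _).map f :=
  funext fun v => LocalTriMuDatum.Iso.toMuIso_toSplitIso (f v)

/-- … packaged as a natural isomorphism `toSplitFunctor ⋙ FSplitTriMuPrimeStrip.toTimesMuFunctor ≅ toTimesMuFunctor`
(identity components). [cite: Mochizuki2012, Def 4.9 (vii) p.158] -/
def toSplitFunctorCompIso :
    toSplitFunctor ⋙ FSplitTriMuPrimeStrip.toTimesMuFunctor ≅
      (toTimesMuFunctor : FTriMuPrimeStrip.{u, v, w} P G X ⥤ FTimesMuPrimeStrip.{u, v, w} P G X) :=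
  NatIso.ofComponents (fun S => Iso.refl _) fun f => by
    erw [Category.comp_id, Category.id_comp]
    exact toTimesMuFunctor_map_toSplitFunctor_map f

end FTriMuPrimeStrip

end Literature.IUT.HodgeArakelov
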